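import Literature.AlgebraicGeometry.Motives.AbelianVarietySymmetricAmpleProofs
import Literature.AlgebraicGeometry.Motives.AbelianVarietyTorsionCubeProofs
import Literature.AlgebraicGeometry.Motives.CartierDivisorOfComplementProofs
import Literature.AlgebraicGeometry.Motives.AbelianVarietyDegreePullback
import Literature.AlgebraicGeometry.Motives.AsymptoticRiemannRochProofs
import Literature.AlgebraicGeometry.Motives.AbelianVarietyTheoremOfCubeProofs
import HarnessLib

/-!
# `deg [n]_A = n^{2g}` from the Theorem of the Cube and Görtz–Wedhorn II, Prop. 23.83 / 23.84

Bookkeeping assembly for the named fact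
`Literature.AlgebraicGeometry.Motives.AbelianVariety.kerRank_zsmul_id A`
(`Motives/AbelianVarietyTorsion`: `deg [n]_A = dim_K Γ(A[n], 𝒪) = n^{2g}` for `n ≠ 0`;
Görtz–Wedhorn, *Algebraic Geometry II*, Prop. 27.186; Mumford, *Abelian Varieties*, §6,
Application 3) and the torsion count `natCard_torsionPoints_of_isAlgClosed A L`, now that
Görtz–Wedhorn II, Lemma 25.150 is proved unconditionally in the tree
(`CartierDivisor.exists_isEffective_avoids_iff_holds`, `Motives/CartierDivisorOfComplementProofs`, on the Auslander–Buchsbaum theorem of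
`Resolution/RegularLocalRingsUFD`).

The printed proof of Prop. 27.186 (p. 887) uses: projectivity (Prop. 27.174, from the theorem of
the square and Lemma 25.150), a symmetric ample line bundle (Rem. 27.185), `[n]^*𝓛 ≅ 𝓛^{n²}`
(Prop. 27.184, from the theorem of the cube), finiteness of `X[n]` (Cor. 13.82), and the degree
computation `deg([n]) deg(𝓛) = deg([n]^*𝓛) = n^{2g} deg(𝓛) > 0` (Prop. 23.84, Rem. 23.85,
Rem. 23.82). Every step is proved in the tree except three printed theorems, kept as named facts:

1. `theoremOfCube_linEquiv` — Görtz–Wedhorn II, Thm. 24.73, the Theorem of the Cube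
   (`Motives/AbelianVarietyTheoremOfCube`; coherent cohomology and base change);
2. `CartierDivisor.asymptoticRiemannRoch_of_isAmple` — Prop. 23.83 with Rem. 23.82
   (`Motives/AbelianVarietyDegree`; coherent cohomology, Snapper polynomials);
3. `CartierDivisor.asympDegree_pullback_eq` — Prop. 23.84 (loc. cit.).

Recorded here (one-line compositions of results already in the tree; the inputs
`isIsogeny_zsmul_id_of_theoremOfCube` (`Motives/AbelianVarietyTorsionCubeProofs`) and
`exists_isAmple_symmetric_of_theoremOfCube` (`Motives/AbelianVarietySymmetricAmpleProofs`) take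
Lemma 25.150 over `K̄` as a hypothesis, which is fed here with the theorem
`CartierDivisor.exists_isEffective_avoids_iff_holds`):

* `kerRank_zsmul_id_of_theoremOfCube` (1 + 2 + 3 ⇒ `kerRank_zsmul_id A`, Prop. 27.186, second
  assertion, for every `n ≠ 0`);
* `natCard_torsionPoints_of_isAlgClosed_of_theoremOfCube` (1 + 2 + 3 ⇒ `#A[n](L) = n^{2g}`,
  Prop. 27.188 (1)).

The alternative degree inputs (G) (two-sided growth `c m^g ≤ h⁰(mD) ≤ C m^g`) and (S) (sandwich
along finite flat maps) of `Motives/AbelianVarietyDegreeGrowth` replace 2 + 3 there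
(`kerRank_zsmul_id_holds_of_growth`); they are not repeated here.

## Update (2026-08-15): the Theorem of the Cube as the sole remaining input

Since then Prop. 23.83 has been *proved* in the tree (`asymptoticRiemannRoch_of_isAmple_holds`,
`Motives/AsymptoticRiemannRochProofs`: comparison with `ℙ^d` through a finite surjective
normalisation and the `h⁰`-sandwich, no coherent cohomology) and Prop. 23.84 derived from it
(`asympDegree_pullback_eq_of_asymptoticRiemannRoch`, `Motives/AbelianVarietyDegreePullback`).
Hence, appended below:

* `CartierDivisor.asympDegree_pullback_eq_holds` — discharge of the named fact Prop. 23.84;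
* `kerRank_zsmul_id_of_theoremOfCube_linEquiv` — **`kerRank_zsmul_id A` from
  `theoremOfCube_linEquiv` alone** (2 and 3 above discharged), and
  `natCard_torsionPoints_of_isAlgClosed_of_theoremOfCube_linEquiv`;
* `kerRank_zsmul_id_of_seesaw`, `natCard_torsionPoints_of_isAlgClosed_of_seesaw` — the same from
  the finest inputs the tree offers for the cube (`theoremOfCube_linEquiv_of_seesaw`,
  `Motives/AbelianVarietyTheoremOfCubeProofs`: closedness of the trivial locus,
  Görtz–Wedhorn II, Thm. 24.66 (1),(3), `seesaw_isClosed_trivialLocus`; descent of a fibrewise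
  trivial class, Thm. 24.66, `seesaw_exists_linEquiv_classPullback`; openness of the trivial locus
  in the cube situation, Lemma 24.72 with Künneth, `theoremOfCube_isOpen_trivialLocus`).

So the trust base of `deg [n]_A = n^{2g}` and of `#A[n](L) = n^{2g}` is now exactly that of the
Theorem of the Cube (coherent cohomology and base change).

## Update (2026-08-15, later): one named fact left

The Theorem of the Cube has meanwhile been reduced in the tree to a single named fact: Step (I) of
Görtz–Wedhorn II, Lemma 24.72 is a theorem (`theoremOfCube_trivialAlong_thickeningPt_holds`,
`Motives/CubeStepI`), the fibre descent is a theorem (`trivialLocus_descendsAlongStages_holds`,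
`Motives/TheoremOfCubeLimitProofs`), and `Motives/AbelianVarietyTheoremOfCubeProofs` records
`theoremOfCube_linEquiv_of_pseudoCoherent_general : cechComplex_pseudoCoherent_general →
theoremOfCube_linEquiv`. Appended below, the corresponding composites for this fact:

* `kerRank_zsmul_id_of_pseudoCoherent_general` — **`kerRank_zsmul_id A` from
  `cechComplex_pseudoCoherent_general` alone** (`Motives/GrothendieckComplexSectionAlongCech`;
  Görtz–Wedhorn II, Thm. 23.133 / Cor. 23.135: the Čech complex of `𝒪(D)` on `X ×_K T` over an
  affine open of `T`, `X → Spec K` proper, is pseudo-coherent — the finiteness theorem for the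
  coherent cohomology of proper morphisms, in Čech form);
* `natCard_torsionPoints_of_isAlgClosed_of_pseudoCoherent_general` — the same for `#A[n](L) = n^{2g}`.

So `kerRank_zsmul_id_holds` is `kerRank_zsmul_id_of_pseudoCoherent_general A
cechComplex_pseudoCoherent_general_holds` the moment that finiteness theorem lands; nothing else
about abelian varieties, divisors, degrees or the cube remains open under this fact.

## References

* U. Görtz, T. Wedhorn, *Algebraic Geometry II: Cohomology of Schemes* (2023),
  doi:10.1007/978-3-658-43031-3: Prop. 23.83/23.84 (p. 447), Thm. 24.66 (p. 542) and Lemma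
  24.72 (p. 548), Thm. 24.73 (p. 550), Lemma 25.150
  (p. 670), Prop. 27.174 (p. 880), Prop. 27.184–27.188 (pp. 886–888). [GortzWedhorn2023]
* D. Mumford, *Abelian Varieties* (1970), §6, Application 1 (p. 62) and Application 3 (p. 64).
  [MumfordAV1970]
-/

universe u

open CategoryTheory AlgebraicGeometry

noncomputable section

namespace Literature.AlgebraicGeometry.Motives

namespace AbelianVariety

variable {K : Type u} [Field K] (A : AbelianVariety K)

/-- **`deg [n]_A = n^{2g}` — the named fact `kerRank_zsmul_id A` — from the three remaining
printed theorems**: the Theorem of the Cube (Görtz–Wedhorn II, Thm. 24.73,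
`theoremOfCube_linEquiv`), asymptotic Riemann–Roch for ample divisors (Prop. 23.83 with Rem. 23.82,
`CartierDivisor.asymptoticRiemannRoch_of_isAmple`) and the degree of pullbacks (Prop. 23.84,
`CartierDivisor.asympDegree_pullback_eq`). This is the printed proof of Prop. 27.186 (p. 887) end
to end: `[n]_A` is an isogeny (`isIsogeny_zsmul_id_of_theoremOfCube`, with Lemma 25.150 over
`K̄` now the theorem `CartierDivisor.exists_isEffective_avoids_iff_holds`), `[n]^*D ∼ n² D` for
symmetric `D` (`pullback_zsmul_id_linEquiv_of_theoremOfCube`, Prop. 27.184 (1) / Rem. 27.185), a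
symmetric ample `D` exists (`exists_isAmple_symmetric_of_theoremOfCube`, likewise), and the leading
coefficients of `h⁰(m [n]^*D)` compare as `deg([n]) δ = n^{2g} δ` with `δ > 0`
(`kerRank_zsmul_id_of_facts_of_isIsogeny`, `Motives/AbelianVarietyDegree`).
[cite: GortzWedhorn2023, Prop. 27.186 (p. 887)] -/
theorem kerRank_zsmul_id_of_theoremOfCube (hcube : theoremOfCube_linEquiv.{u})
    (h₁ : CartierDivisor.asymptoticRiemannRoch_of_isAmple.{u})
    (h₂ : CartierDivisor.asympDegree_pullback_eq.{u}) : kerRank_zsmul_id A :=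
  have hdiv : ∀ B : AbelianVariety (AlgebraicClosure K),
      CartierDivisor.exists_isEffective_avoids_iff B.X.left :=
    fun B => CartierDivisor.exists_isEffective_avoids_iff_holds (X := B.X.left)
  kerRank_zsmul_id_of_facts_of_isIsogeny (isIsogeny_zsmul_id_of_theoremOfCube (A := A) hcube hdiv)
    h₁ h₂ (pullback_zsmul_id_linEquiv_of_theoremOfCube (A := A) hcube)
    (exists_isAmple_symmetric_of_theoremOfCube (A := A) hcube hdiv)

/-- **`#A[n](L) = n^{2g}` for `L ⊇ K` algebraically closed and `n` invertible in `K`** — the named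
fact `natCard_torsionPoints_of_isAlgClosed A L` (Görtz–Wedhorn II, Prop. 27.188 (1); Mumford §6,
Application 3, Proposition p. 64) — from the same three printed theorems, via
`kerRank_zsmul_id_of_theoremOfCube` and the proved étaleness of `[n]_A`
(`natCard_torsionPoints_of_isAlgClosed_of_kerRank`, `Motives/AbelianVarietyLie`).
[cite: GortzWedhorn2023, Prop. 27.188 (1) (p. 888)] -/
theorem natCard_torsionPoints_of_isAlgClosed_of_theoremOfCube (L : Type u) [Field L] [Algebra K L]
    (hcube : theoremOfCube_linEquiv.{u}) (h₁ : CartierDivisor.asymptoticRiemannRoch_of_isAmple.{u})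
    (h₂ : CartierDivisor.asympDegree_pullback_eq.{u}) : natCard_torsionPoints_of_isAlgClosed A L :=
  natCard_torsionPoints_of_isAlgClosed_of_kerRank (A := A) L
    (kerRank_zsmul_id_of_theoremOfCube A hcube h₁ h₂)

/-! ### Update: Prop. 23.83 and 23.84 discharged — the cube as the sole remaining input -/

/-- **Görtz–Wedhorn II, Prop. 23.84 (degree of pullbacks, `h⁰`-asymptotic form), discharged**: the
named fact `CartierDivisor.asympDegree_pullback_eq` (`Motives/AbelianVarietyDegree`) holds, being
derived from Prop. 23.83 (`asympDegree_pullback_eq_of_asymptoticRiemannRoch`,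
`Motives/AbelianVarietyDegreePullback`), which is proved
(`asymptoticRiemannRoch_of_isAmple_holds`, `Motives/AsymptoticRiemannRochProofs`).
[cite: GortzWedhorn2023, Prop. 23.84 (p. 447)] -/
theorem _root_.Literature.AlgebraicGeometry.Motives.CartierDivisor.asympDegree_pullback_eq_holds :
    CartierDivisor.asympDegree_pullback_eq.{u} :=
  CartierDivisor.asympDegree_pullback_eq_of_asymptoticRiemannRoch
    CartierDivisor.asymptoticRiemannRoch_of_isAmple_holds

/-- **`deg [n]_A = n^{2g}` — the named fact `kerRank_zsmul_id A` — from the Theorem of the Cube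
alone** (Görtz–Wedhorn II, Prop. 27.186 with Thm. 24.73): `kerRank_zsmul_id_of_theoremOfCube`
with its two other hypotheses discharged, Prop. 23.83 by `asymptoticRiemannRoch_of_isAmple_holds`
and Prop. 23.84 by `asympDegree_pullback_eq_holds`. The Theorem of the Cube
(`theoremOfCube_linEquiv`, coherent cohomology and base change) is thus the entire trust base of
the fact. [cite: GortzWedhorn2023, Prop. 27.186 (p. 887) with Thm. 24.73 (p. 550)] -/
theorem kerRank_zsmul_id_of_theoremOfCube_linEquiv (hcube : theoremOfCube_linEquiv.{u}) :
    kerRank_zsmul_id A :=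
  kerRank_zsmul_id_of_theoremOfCube A hcube CartierDivisor.asymptoticRiemannRoch_of_isAmple_holds
    CartierDivisor.asympDegree_pullback_eq_holds

/-- **`#A[n](L) = n^{2g}` (`L ⊇ K` algebraically closed, `n` invertible in `K`) — the named fact
`natCard_torsionPoints_of_isAlgClosed A L` — from the Theorem of the Cube alone** (Görtz–Wedhorn II,
Prop. 27.188 (1); Mumford §6, Application 3): `kerRank_zsmul_id_of_theoremOfCube_linEquiv` and the
proved étaleness of `[n]_A` (`natCard_torsionPoints_of_isAlgClosed_of_kerRank`).
[cite: GortzWedhorn2023, Prop. 27.188 (1) (p. 888) with Thm. 24.73 (p. 550)] -/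
theorem natCard_torsionPoints_of_isAlgClosed_of_theoremOfCube_linEquiv (L : Type u) [Field L]
    [Algebra K L] (hcube : theoremOfCube_linEquiv.{u}) : natCard_torsionPoints_of_isAlgClosed A L :=
  natCard_torsionPoints_of_isAlgClosed_of_kerRank (A := A) L
    (kerRank_zsmul_id_of_theoremOfCube_linEquiv A hcube)

/-- **`deg [n]_A = n^{2g}` from the seesaw theorem and the local form of the theorem of the cube** —
the finest trust base available in the tree (Görtz–Wedhorn II, proof of Thm. 24.73, p. 550):
closedness of the trivial locus of a family of divisor classes (Thm. 24.66 (1), (3),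
`seesaw_isClosed_trivialLocus`), descent of a fibrewise trivial class to the integral base
(Thm. 24.66, `seesaw_exists_linEquiv_classPullback`) and openness of the trivial locus in the cube
situation (Lemma 24.72 with the Künneth formula, `theoremOfCube_isOpen_trivialLocus`) give the
Theorem of the Cube (`theoremOfCube_linEquiv_of_seesaw`,
`Motives/AbelianVarietyTheoremOfCubeProofs`) and hence the fact
(`kerRank_zsmul_id_of_theoremOfCube_linEquiv`).
[cite: GortzWedhorn2023, Prop. 27.186 (p. 887) with Thm. 24.66, Lemma 24.72 (pp. 542–550)] -/
theorem kerRank_zsmul_id_of_seesaw (hA : seesaw_isClosed_trivialLocus.{u})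
    (hB : seesaw_exists_linEquiv_classPullback.{u}) (hC : theoremOfCube_isOpen_trivialLocus.{u}) :
    kerRank_zsmul_id A :=
  kerRank_zsmul_id_of_theoremOfCube_linEquiv A (theoremOfCube_linEquiv_of_seesaw hA hB hC)

/-- **`#A[n](L) = n^{2g}` from the seesaw theorem and the local form of the theorem of the cube**
(as `kerRank_zsmul_id_of_seesaw`; Görtz–Wedhorn II, Prop. 27.188 (1)).
[cite: GortzWedhorn2023, Prop. 27.188 (1) (p. 888) with Thm. 24.66, Lemma 24.72 (pp. 542–550)] -/
theorem natCard_torsionPoints_of_isAlgClosed_of_seesaw (L : Type u) [Field L] [Algebra K L]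
    (hA : seesaw_isClosed_trivialLocus.{u}) (hB : seesaw_exists_linEquiv_classPullback.{u})
    (hC : theoremOfCube_isOpen_trivialLocus.{u}) : natCard_torsionPoints_of_isAlgClosed A L :=
  natCard_torsionPoints_of_isAlgClosed_of_theoremOfCube_linEquiv A L
    (theoremOfCube_linEquiv_of_seesaw hA hB hC)

/-! ### One named fact left: the pseudo-coherence of the Čech complex of `𝒪(D)` -/

/-- **`deg [n]_A = n^{2g}` from the finiteness theorem for proper morphisms alone**
(Görtz–Wedhorn II, Prop. 27.186, p. 887: "`[n]_X` is an isogeny of degree `n^{2g}`"): the named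
fact `kerRank_zsmul_id A` for every abelian variety `A` over every field, from the single named
fact `cechComplex_pseudoCoherent_general` (`Motives/GrothendieckComplexSectionAlongCech`;
Görtz–Wedhorn II, Thm. 23.133 / Cor. 23.135 in Čech form for `𝒪(D)`), by
`theoremOfCube_linEquiv_of_pseudoCoherent_general` (`Motives/AbelianVarietyTheoremOfCubeProofs`:
the Theorem of the Cube, Thm. 24.73, with Step (I) of Lemma 24.72 and the fibre descent proved)
and `kerRank_zsmul_id_of_theoremOfCube_linEquiv` (this file: projectivity, Prop. 27.174; a
symmetric ample class, Rem. 27.185; `[n]^*𝓛 ≅ 𝓛^{n²}`, Prop. 27.184; `[n]` an isogeny; the degree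
computation through Prop. 23.83 / 23.84, all proved). The discharge `kerRank_zsmul_id_holds` is
this theorem applied to `cechComplex_pseudoCoherent_general_holds` once Thm. 23.133 lands.
[cite: GortzWedhorn2023, Prop. 27.186 (p. 887) with Thm. 24.73 (p. 550) and Thm. 23.133 / Cor. 23.135 (pp. 478–480)] -/
theorem kerRank_zsmul_id_of_pseudoCoherent_general (h : cechComplex_pseudoCoherent_general.{u}) :
    kerRank_zsmul_id A :=
  kerRank_zsmul_id_of_theoremOfCube_linEquiv A (theoremOfCube_linEquiv_of_pseudoCoherent_general h)

/-- **`#A[n](L) = n^{2g}` over algebraically closed `L ⊇ K` for `n` invertible in `K`, from the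
finiteness theorem for proper morphisms alone** (Görtz–Wedhorn II, Prop. 27.188 (1), p. 888), as
`kerRank_zsmul_id_of_pseudoCoherent_general`, through
`natCard_torsionPoints_of_isAlgClosed_of_theoremOfCube_linEquiv`.
[cite: GortzWedhorn2023, Prop. 27.188 (1) (p. 888) with Thm. 24.73 (p. 550) and Thm. 23.133 / Cor. 23.135 (pp. 478–480)] -/
theorem natCard_torsionPoints_of_isAlgClosed_of_pseudoCoherent_general (L : Type u) [Field L]
    [Algebra K L] (h : cechComplex_pseudoCoherent_general.{u}) :
    natCard_torsionPoints_of_isAlgClosed A L :=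
  natCard_torsionPoints_of_isAlgClosed_of_theoremOfCube_linEquiv A L
    (theoremOfCube_linEquiv_of_pseudoCoherent_general h)

end AbelianVariety

end Literature.AlgebraicGeometry.Motives

end
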